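import Literature.AlgebraicGeometry.Modules.LocalFrames
import Literature.AlgebraicGeometry.KTheory.PullbackVectorBundle
import Mathlib.AlgebraicGeometry.Modules.Tilde
import Mathlib.RingTheory.Flat.Localization
import Mathlib.RingTheory.Flat.Stability
import Mathlib.LinearAlgebra.Dimension.Free
import HarnessLib

/-!
# Formally free cokernel — sections of finite locally free modules on affine schemes

Helper file for stub ED (`stub_formallyFreeCokernel`) of line `chow-zariski-pushforward` of the crux
`PadicSemiregularLift.FormalVectorBundlesAlgebraize` (stmt-HodgeConjecture-14106). Section-level
facts about finite locally free `𝒪_X`-modules (`Literature.AlgebraicGeometry.Motives.IsFiniteLocallyFree`):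

* `isFiniteLocallyFree_of_iso` — invariance under isomorphism;
* `nonempty_sectionsEquivFun`, `free_sections`, `finite_sections` — a trivialisation
  `𝒪^I ≅ E|_W` (`I` finite) makes `Γ(E, W)` a free `Γ(X, W)`-module with basis the basis sections
  (coordinates in the dual frame, `Literature.AlgebraicGeometry.Modules.eq_sum_coord_smul`);
* `flat_sections_of_isFiniteLocallyFree` — on `Spec R`, the global sections of a finite locally free
  module form a FLAT `R`-module (free on a covering by basic opens `D(f)`, where the sections are the
  localisation `Γ(M, ⊤)[1/f]` by quasi-coherence, Mathlib `isIso_fromTildeΓ_iff_isLocalizing`; flatness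
  is local, Mathlib `Module.flat_of_isLocalized_span`);
* `exists_free_iso_of_free_sections` — conversely a quasi-coherent module on `Spec R` whose global
  sections form a finite free `R`-module is `𝒪^n` (`M ≅ Γ(M)~`, Mathlib `tildeFinsupp`).

Everything is proved; no definitions.
-/

-- `Summit.HodgeConjecture.HodgeConjecture.…` repeats the summit name by the D-0017 layout (Sub = Summit).
set_option linter.dupNamespace false

noncomputable section

universe u

open CategoryTheory CategoryTheory.Limits AlgebraicGeometry Opposite TopologicalSpace
open Literature.AlgebraicGeometry.Motives Literature.AlgebraicGeometry.Modules

namespace Summit.HodgeConjecture.HodgeConjecture.Theorems.FormalVectorBundlesAlgebraize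

variable {X : Scheme.{u}}

/-- Finite local freeness is invariant under isomorphisms of `𝒪_X`-modules. -/
theorem isFiniteLocallyFree_of_iso {E E' : X.Modules} (e : E ≅ E') (h : IsFiniteLocallyFree E) :
    IsFiniteLocallyFree E' := by
  intro x
  obtain ⟨U, hx, I, hI, ⟨t⟩⟩ := h x
  exact ⟨U, hx, I, hI, ⟨t ≪≫ (Scheme.Modules.overFunctor U).mapIso e⟩⟩

/-! ### Sections of a trivialised module are free on the basis sections -/

section Frame

variable {E : X.Modules} {W : X.Opens} {I : Type u} [Fintype I]

/-- **Coordinates give a linear equivalence `Γ(E, W) ≃ Γ(X, W)^I`** for a trivialisation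
`e : 𝒪^I ≅ E|_W`: `s ↦ (λ_i(s))_i` with inverse `c ↦ ∑ c_i b_i` (basis expansion
`s = ∑ λ_i(s) b_i` and `λ_i(b_j) = δ_ij`). -/
theorem nonempty_sectionsEquivFun (e : SheafOfModules.free I ≅ E.over W) :
    Nonempty {φ : Γ(E, W) ≃ₗ[Γ(X, W)] (I → Γ(X, W)) // ∀ c, φ.symm c = ∑ i, c i • basisSection e i} := by
  classical
  let crd : Γ(E, W) →ₗ[Γ(X, W)] (I → Γ(X, W)) :=
    { toFun := fun s i => coord e (𝟙 W) s i
      map_add' := fun s t => funext fun i => by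
        simp only [coord_def, appLE_add_right]
        rfl
      map_smul' := fun r s => funext fun i => by
        simp only [coord_def, appLE_smul_right, RingHom.id_apply]
        rfl }
  have crd_apply : ∀ s i, crd s i = coord e (𝟙 W) s i := fun _ _ => rfl
  let cmb : (I → Γ(X, W)) →ₗ[Γ(X, W)] Γ(E, W) :=
    Fintype.linearCombination Γ(X, W) (fun i => basisSection e i)
  have cmb_apply : ∀ c, cmb c = ∑ i, c i • basisSection e i := fun c =>
    Fintype.linearCombination_apply _ _ _
  have h₁ : ∀ s, cmb (crd s) = s := by
    intro s
    rw [cmb_apply]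
    conv_rhs => rw [eq_sum_coord_smul e (𝟙 W) s]
    refine Finset.sum_congr rfl fun i _ => ?_
    rw [crd_apply, op_id, E.presheaf.map_id]
    rfl
  have hlin : ∀ (c : I → Γ(X, W)) (j : I) (t : Finset I),
      coord e (𝟙 W) (∑ i ∈ t, c i • basisSection e i) j =
        ∑ i ∈ t, c i * coord e (𝟙 W) (basisSection e i) j := by
    intro c j t
    induction t using Finset.induction_on with
    | empty =>
      rw [Finset.sum_empty, Finset.sum_empty, coord_def, appLE_zero_right]
      rfl
    | insert a t ha ih =>
      rw [Finset.sum_insert ha, Finset.sum_insert ha, coord_def, appLE_add_right,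
        appLE_smul_right, ← coord_def, ← coord_def, ih]
      rfl
  have h₂ : ∀ c, crd (cmb c) = c := by
    intro c
    funext j
    rw [crd_apply, cmb_apply, hlin, Finset.sum_eq_single j, coord_basisSection, if_pos rfl, mul_one]
    · intro i _ hij
      rw [coord_basisSection, if_neg hij, mul_zero]
    · intro hj
      exact absurd (Finset.mem_univ j) hj
  exact ⟨⟨LinearEquiv.ofLinear crd cmb (LinearMap.ext h₂) (LinearMap.ext h₁), fun c => cmb_apply c⟩⟩

/-- **Sections of a trivialised module are free**: `Γ(E, W)` is a free `Γ(X, W)`-module for a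
trivialisation `e : 𝒪^I ≅ E|_W` with `I` finite. -/
theorem free_sections (e : SheafOfModules.free I ≅ E.over W) : Module.Free Γ(X, W) Γ(E, W) := by
  obtain ⟨⟨φ, -⟩⟩ := nonempty_sectionsEquivFun e
  exact Module.Free.of_equiv φ.symm

/-- Sections of a trivialised module of finite rank form a finite module. -/
theorem finite_sections (e : SheafOfModules.free I ≅ E.over W) :
    Module.Finite Γ(X, W) Γ(E, W) := by
  obtain ⟨⟨φ, -⟩⟩ := nonempty_sectionsEquivFun e
  exact Module.Finite.equiv φ.symm

end Frame

/-! ### Affine schemes: flat sections, free sections -/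

section Affine

variable {R : CommRingCat.{u}}

/-- **Global sections of a finite locally free module on `Spec R` are flat over `R`.** Near every
point the module is free on a basic open `D(f)`, so `Γ(M, D(f))` is free over `Γ(D(f)) = R[1/f]`,
hence flat over `R`; and `Γ(M, D(f)) = Γ(M, ⊤)[1/f]` by quasi-coherence; flatness is local. -/
theorem flat_sections_of_isFiniteLocallyFree (M : (Spec R).Modules) (hM : IsFiniteLocallyFree M) :
    Module.Flat R Γ(M, ⊤) := by
  classical
  haveI := hM.isVectorBundle.isLocallyFree
  have hloc := (isIso_fromTildeΓ_iff_isLocalizing M).mp inferInstance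
  -- near every point, a basic open on which the sections are flat
  have key : ∀ x : Spec R, ∃ f : R, x ∈ PrimeSpectrum.basicOpen f ∧
      Module.Flat R ((modulesSpecToSheaf.obj M).obj.obj (op (PrimeSpectrum.basicOpen f))) := by
    intro x
    obtain ⟨U, hxU, I, hI, ⟨e⟩⟩ := hM x
    obtain ⟨_, ⟨f, rfl⟩, hxf, hfU⟩ :=
      (PrimeSpectrum.isTopologicalBasis_basic_opens (R := R)).exists_subset_of_mem_open hxU U.2
    haveI := Fintype.ofFinite I
    let e' := SheafOfModules.restrictTrivialisation (R := (Spec R).ringCatSheaf)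
      (homOfLE hfU : PrimeSpectrum.basicOpen f ⟶ U) e
    haveI : Module.Free Γ(Spec R, PrimeSpectrum.basicOpen f) Γ(M, PrimeSpectrum.basicOpen f) :=
      free_sections e'
    haveI : Module.Flat R Γ(Spec R, PrimeSpectrum.basicOpen f) :=
      IsLocalization.flat _ (Submonoid.powers f)
    have hfl : Module.Flat R Γ(M, PrimeSpectrum.basicOpen f) :=
      Module.Flat.trans R Γ(Spec R, PrimeSpectrum.basicOpen f) _
    exact ⟨f, hxf, hfl⟩
  choose f hf hflat using key
  have hspan : Ideal.span (Set.range f) = ⊤ := by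
    rw [← PrimeSpectrum.iSup_basicOpen_eq_top_iff, ← top_le_iff]
    intro x _
    exact Opens.mem_iSup.mpr ⟨x, hf x⟩
  have hF : Module.Flat R ((modulesSpecToSheaf.obj M).obj.obj (op ⊤)) := by
    refine Module.flat_of_localized_span _ _ (Set.range f) hspan (fun r => ?_)
    obtain ⟨_, x, rfl⟩ := r
    haveI := hloc (f x)
    haveI := hflat x
    exact Module.Flat.of_linearEquiv (IsLocalizedModule.iso (Submonoid.powers (f x))
      ((modulesSpecToSheaf.obj M).obj.map (PrimeSpectrum.basicOpen (f x)).leTop.op).hom)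
  exact hF

/-- **A quasi-coherent module on `Spec R` with finite free global sections is free**:
`M ≅ Γ(M)~ ≅ (R^I)~ ≅ 𝒪^I`. -/
theorem exists_free_iso_of_free_sections (M : (Spec R).Modules) [M.IsQuasicoherent]
    [Module.Free R Γ(M, ⊤)] [Module.Finite R Γ(M, ⊤)] :
    ∃ (I : Type u) (_ : Finite I), Nonempty (SheafOfModules.free (R := (Spec R).ringCatSheaf) I ≅ M) := by
  let b := Module.Free.chooseBasis R Γ(M, ⊤)
  refine ⟨Module.Free.ChooseBasisIndex R Γ(M, ⊤), inferInstance, ⟨?_⟩⟩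
  let e : ModuleCat.of R (Module.Free.ChooseBasisIndex R Γ(M, ⊤) →₀ R) ≅
      (modulesSpecToSheaf.obj M).presheaf.obj (op ⊤) :=
    b.repr.symm.toModuleIso
  have h : IsIso M.fromTildeΓ := inferInstance
  exact (tildeFinsupp _).symm ≪≫ (tilde.functor R).mapIso e ≪≫ @asIso _ _ _ _ _ h

end Affine

/-- **Registered sub-goal** (helper stub of `stub_formallyFreeCokernel`, universe `0`): global
sections of a finite locally free module on an affine scheme are flat
(`flat_sections_of_isFiniteLocallyFree`). -/
theorem stub_ffcFlatSections :
  ∀ (R : CommRingCat.{0}) (M : (AlgebraicGeometry.Spec R).Modules), Literature.AlgebraicGeometry.Motives.IsFiniteLocallyFree M → Module.Flat R ((AlgebraicGeometry.Scheme.Modules.presheaf M).obj (Opposite.op ⊤)) :=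
  fun _ M hM => flat_sections_of_isFiniteLocallyFree M hM

end Summit.HodgeConjecture.HodgeConjecture.Theorems.FormalVectorBundlesAlgebraize

end
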